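/-
Copyright: lit-balaban cell, Phase-2 proof seat p33 (gen 6).  Statement-level skeleton of a published paper; no proof claims beyond
what the kernel checks below.
-/
import Literature.MathematicalPhysics.QuantumFieldTheory.BalabanImbrieJaffe1984to88.BIJ85Ineq732PullBack
import Literature.MathematicalPhysics.QuantumFieldTheory.BalabanImbrieJaffe1984to88.BIJ85HolonomyDeviation
import Literature.MathematicalPhysics.QuantumFieldTheory.BalabanImbrieJaffe1984to88.BIJ85BlockKPoincare

/-!
# `BalabanImbrieJaffe1984to88.BIJ85Ineq732Background` — T. Bałaban, J. Imbrie, A. Jaffe, *Renormalization of the Higgs model: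
minimizers, propagators and the stability of mean field theory*, Commun. Math. Phys. **97** (1985) 299–329
[BalabanImbrieJaffe1985]: the scalar stability estimate **(7.3.2)** p. 326 AT THE `(4.5.4)`-SHAPED BACKGROUND
`u = Q^{s*}_k v · e^{iθ}` — the pull-back (4.5.2)/(4.5.3) of an ARBITRARY unit-lattice `U(1)` field `v` times an ARBITRARY bondwise phase
`e^{iθ_b}` (in print `θ = −e_kη·𝒟_k∂^*Q^{e*}_kf^{(k)}`) — under the sole hypothesis that the phase is SUP-NORM SMALL on the scale of the
block: `|θ_b| ≤ T` with `τ := L^k·T` small (`τ = e_k‖𝒟_k∂^*Q^{e*}_kf^{(k)}‖_∞` at `η = L^{−k}`).  THIS FILE: the holonomy defect, the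
block-averaging inequality with its `τ²`-defect, and the coercivity at this background (file 4 of this seat's member of SKELETON row
**C1.Eq7.3.1-7.3.2**; files 1–3: `BIJ85Ineq732PullBack` p262642, `BIJ85HolonomyDeviation` p263367, `BIJ85BlockKPoincare` p264017; the assembly
= file 5 `BIJ85Ineq732BackgroundStab`).

statement-level skeleton of published theorems with citation tags; proofs where landed; nothing here is a claim about the Yang–Mills mass gap

PDF held: `paper:balaban1985-cmp97-bij-higgs-minimizers` (journal page = PDF page + 298).  Pages read (`lit read`, OCR text): p. 302–303
[PDF 4–5], p. 312–313 [PDF 14–15] ((4.5.2)–(4.5.4), (4.6.1)–(4.6.4)), p. 326 [PDF 28] ((7.3.1)–(7.3.2)).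

CITATION HEADER (lean-in-tree rule).  Phase-2 file of the lit-balaban TYPED SKELETON (HOME `run/shared/lean/pub/lit-balaban/`), seat p33 gen 6
(unit `lit-balaban-p33-g6`; TAKING line HOME/STATUS.md 2026-08-21T10:38:53Z; owner r15, referee ref-5; GAPS G-C1-05).  Carriers and operators
of record only, BY NAME: p31's `BIJ85Eq453GaugeField.qsstarGIter k v` (the group pull-back (4.5.2)/(4.5.3)), r18's `expU1`, p11's `holCK`/`qCovK`/
`QlinK`/`Dlin`/`deltaOp`/`bondForm` and covariant block-averaging inequality `BIJ85BlockAveragingIneqCov.sum_norm_qCovK_shift_sub_sq_le_cov`,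
this seat's `holCK_qsstarGIter`/`toC_runProd_qsstarGIter` (file 1), `norm_holCK_sub_one_le`/`holCK_mul`/`runProd_mul` (file 2),
`sum_norm_sq_le_cov` (file 3).  Two definitions with bodies (`phase θ`, `bg454 k v θ` = the background), no structure, no instance, no fact.

THE PRINTED TEXT, verbatim (p. 313 [PDF 15], p. 326 [PDF 28]): *"(u_k)_b = (Q^{s*}_kv)_b exp[−ie_kη(𝒟_k∂^*Q^{e*}_kf^{(k)})_b]. (4.5.4)"*;
*"let us assume that for the unit lattice field v, |v(∂p) − 1| ≤ e_k𝓅(e_k), (7.3.1) … For constants γ > 0, α > 0, M < ∞,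
⟨φ, Δ_k(u_k)φ⟩ ≥ γ Σ_{b∈T₁^{(k)}} |u_k(b)φ(b₊) − φ(b₋)|² − Me_k^{2−α} Σ_{x∈T₁^{(k)}} |φ(x)|². (7.3.2)  The second form of the inequality substitutes
v_b for u_k(b) in the covariant derivative of φ. These inequalities can be proved by an extension of the proofs of [7]. … by change of gauge
u_k can be transformed in a local region Λ into a configuration of the form exp[ie_kηA], where A is smooth and small."*

WHAT IS PROVED (0 `sorry`, standard axioms; second printed form, `v_b` in the covariant derivative of `ψ`).
* §1 the background `bg454 k v θ = Q^{s*}_kv·e^{iθ}`: `= e^{iθ_b}` on bonds inside `k`-blocks (`bg454_of_interior`); its composite tree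
  transports and straight-run transports FACTOR (`holCK_bg454`: `= ` those of the phase; `toC_runProd_bg454`: `= v_c ·` those of the phase).
* §2 **THE HOLONOMY DEFECT IS `O(τ)`**: the loop holonomy `ρ_μ(x)` of p11's covariant block-averaging inequality at `(u, W) = (bg454 k v θ, v)`
  is a product of three PHASE transports (the `v`'s cancel, as in file 1) and `|ρ_μ(x) − 1| ≤ (2d+1)·L^kT` (`norm_defect_bg454_sub_one_le`);
  hence the block-averaging inequality with an explicit `τ²`-defect (`sum_norm_qCovK_bg454_shift_sub_sq_le`).
* §3 **COERCIVITY**: if `4d(d+1)τ² ≤ 1` then `Σ_x|φ(x)|² ≤ 4n²·Σ_b|u_bφ(b₊) − φ(b₋)|² + 4N·Σ_y|(Q_k(u)φ)(y)|²` (`sum_norm_sq_le_bg454`, file 3's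
  `sum_norm_sq_le_cov` with `|u_b − 1| ≤ T` inside blocks and `|u(Γ^{(k)}) − 1| ≤ d(L^k − 1)T`).
* §4 the block-averaging bound in the `ℓ²` bookkeeping (`bondForm_qlinK_bg454_le`): `E_v(Q_k(u)φ) ≤ (n²/N)(2 + 8d(2d+1)²τ²)·Σ_b|u_bφ(b₊) −
  φ(b₋)|² + 8d(2d+1)²τ²·‖Q_k(u)φ‖²` — the input of the assembly in the sequel file `BIJ85Ineq732BackgroundStab` ((7.3.2) at this background with
  `γ = min(a/(10d), ⅕)` and mass coefficient `32γd(2d+1)²τ²`).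
HONEST SCOPE.  The link from (7.3.1) to the sup-norm smallness of the phase is the typed row C1.Eq7.2.2 (B5 Prop. 1.2-type bounds on
`𝒟_k`), not proved here; no Hölder regularity of the phase is used or needed for THIS inequality (only `‖θ‖_∞`), which is weaker than what the
printed route through [7] would give (regularity AND decay of `G_k(u_k)`) but is exactly (7.3.2).  Nothing printed is contradicted or weakened.
-/

open scoped RealInnerProductSpace BigOperators
open Finset

namespace Literature.MathematicalPhysics.QuantumFieldTheory.BalabanImbrieJaffe1984to88.BIJ85Ineq732Background

open Literature.MathematicalPhysics.QuantumFieldTheory.Balaban1983to89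
open BIJ88Sect3Statements (U1 toC norm_toC toC_one toC_mul)
open BIJ85Sect1Model (HiggsField)
open B7SectAStatements (blockOfIter blockOfIter_zero blockOfIter_succ)
open BIJ85BlockAveragesTorus BIJ85BlockAveragesTorusK BIJ85ScalarPropagatorTorus BIJ85ScalarPropagatorTorusK
open BIJ85ScalarForm464
open BIJ85BlockAveragingIneq BIJ85BlockAveragingIneqCov BIJ85Ineq732Flat BIJ85Ineq732PullBack BIJ85HolonomyDeviation BIJ85BlockKPoincare
open BIJ85Eq453GaugeField (qsstarGIter qsstarGIter_of_interior)

noncomputable section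

variable {P : Params} {j : ℕ}

/-! ## §0 Torus bookkeeping -/

/-- kernel: p11's `blkIter` and B7's `blockOfIter` are the same iterate of `blockOf`. [cite: BalabanImbrieJaffe1985, (5.1.2) p.313] -/
theorem blkIter_eq_blockOfIter : ∀ (k : ℕ) (x : Balaban1983to89.Site P j), blkIter k x = blockOfIter k x
  | 0, _ => rfl
  | k + 1, x => by rw [blkIter_succ, blockOfIter_succ, blkIter_eq_blockOfIter k x]

/-- Sums over the torus are invariant under the translation `x ↦ x + ne_μ`. [folklore] -/
private theorem sum_runSite_eq {α : Type*} [AddCommMonoid α] (μ : Fin P.d) (n : ℕ) (F : Balaban1983to89.Site P j → α) :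
    ∑ x : Balaban1983to89.Site P j, F (runSite x μ n) = ∑ x : Balaban1983to89.Site P j, F x := by
  refine Fintype.sum_bijective _ (Finite.injective_iff_bijective.1 fun x y h => ?_) _ _ fun _ => rfl
  funext κ
  have hκ := congrFun h κ
  by_cases e : κ = μ
  · subst e
    simpa only [runSite, Function.update_self, add_left_inj] using hκ
  · simpa only [runSite, Function.update_of_ne e] using hκ

/-! ## §1 The background (4.5.4): pull-back times a bondwise phase -/

/-- The bondwise PHASE field `b ↦ e^{iθ_b}` (in print `θ = −e_kη(𝒟_k∂^*Q^{e*}_kf^{(k)})`, the second factor of (4.5.4)).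
[cite: BalabanImbrieJaffe1985, (4.5.4) p.313] -/
def phase (θ : PBond P j → ℝ) : GaugeField P j U1 := fun b => expU1 (θ b)

/-- **The background (4.5.4)** `u_b = (Q^{s*}_kv)_b · e^{iθ_b}` on the bonds of `T^{(j)}` (`η`-lattice), for a unit-lattice field `v` on the bonds
of `T^{(j+k)}` and a bondwise phase `θ` (p31's group pull-back `qsstarGIter`, r18's `expU1`). [cite: BalabanImbrieJaffe1985, (4.5.4) p.313] -/
def bg454 (k : ℕ) (v : GaugeField P (j + k) U1) (θ : PBond P j → ℝ) : GaugeField P j U1 := fun b => qsstarGIter k v b * phase θ b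

/-- kernel: unfolding. [cite: BalabanImbrieJaffe1985, (4.5.4) p.313] -/
theorem bg454_def (k : ℕ) (v : GaugeField P (j + k) U1) (θ : PBond P j → ℝ) :
    bg454 k v θ = fun b => qsstarGIter k v b * phase θ b := rfl

/-- kernel: a bondwise phase bound `|θ_b| ≤ T` gives `|e^{iθ_b} − 1| ≤ T`. [cite: BalabanImbrieJaffe1985, (4.5.4) p.313] -/
theorem norm_toC_phase_sub_one_le {θ : PBond P j → ℝ} {T : ℝ} (hθ : ∀ b, |θ b| ≤ T) (b : PBond P j) :
    ‖toC (phase θ b) - 1‖ ≤ T :=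
  (norm_toC_expU1_sub_one_le (θ b)).trans (hθ b)

/-- **(4.5.3) inside the blocks**: on a bond with both ends in one `k`-block the background (4.5.4) IS the phase, `u_b = e^{iθ_b}` (p31's
`qsstarGIter_of_interior`; standing range). [cite: BalabanImbrieJaffe1985, (4.5.3) p.312] -/
theorem bg454_of_interior {k : ℕ} (hk : j + k ≤ P.m + P.K) (v : GaugeField P (j + k) U1) (θ : PBond P j → ℝ) {b : PBond P j}
    (hb : blkIter k b.src = blkIter k b.tgt) : bg454 k v θ b = phase θ b := by
  rw [blkIter_eq_blockOfIter, blkIter_eq_blockOfIter] at hb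
  show qsstarGIter k v b * phase θ b = phase θ b
  rw [qsstarGIter_of_interior hk v hb, one_mul]

/-- **The composite tree transports of the background are those of the phase**: `u(Γ^{(k)}_{x_k,x}) = e^{iθ}(Γ^{(k)}_{x_k,x})` (file 2's
multiplicativity `holCK_mul`, file 1's `holCK_qsstarGIter = 1`). [cite: BalabanImbrieJaffe1985, (5.1.2)–(5.1.3) p.313] -/
theorem holCK_bg454 {k : ℕ} (hk : j + k ≤ P.m + P.K) (v : GaugeField P (j + k) U1) (θ : PBond P j → ℝ)
    (x : Balaban1983to89.Site P j) : holCK (bg454 k v θ) k x = holCK (phase θ) k x := by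
  rw [bg454_def, holCK_mul, holCK_qsstarGIter k hk, one_mul]

/-- **The straight-run transports of the background factor**: `u(run_{x,μ,L^k}) = v(⟨x_k, x_k+e_μ⟩)·e^{iθ}(run_{x,μ,L^k})` (file 2's `runProd_mul`,
file 1's `toC_runProd_qsstarGIter`). [cite: BalabanImbrieJaffe1985, (4.5.3) p.312] -/
theorem toC_runProd_bg454 {k : ℕ} (hk : j + k ≤ P.m + P.K) (v : GaugeField P (j + k) U1) (θ : PBond P j → ℝ)
    (x : Balaban1983to89.Site P j) (μ : Fin P.d) :
    toC (runProd (bg454 k v θ) x μ (P.L ^ k)) = toC (v ⟨blkIter k x, μ⟩) * toC (runProd (phase θ) x μ (P.L ^ k)) := by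
  rw [bg454_def, runProd_mul, toC_mul, toC_runProd_qsstarGIter k hk]

/-! ## §2 The holonomy defect at `(u, W) = (Q^{s*}_kv·e^{iθ}, v)` is `O(L^kT)` -/

/-- kernel: **the `v`'s cancel in the loop holonomy** — `ρ_μ(x) = u(Γ^{(k)}_x)^{−1}·v_c·u(Γ^{(k)}_{x+ne_μ})·u(run_{x,μ,n})^{−1}
= e^{iθ}(Γ^{(k)}_x)^{−1}·e^{iθ}(Γ^{(k)}_{x+ne_μ})·e^{iθ}(run_{x,μ,n})^{−1}` (`c = ⟨x_k, x_k+e_μ⟩`, `n = L^k`). [cite: BalabanImbrieJaffe1985, (2.10) p.303] -/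
theorem defect_bg454_eq {k : ℕ} (hk : j + k ≤ P.m + P.K) (v : GaugeField P (j + k) U1) (θ : PBond P j → ℝ)
    (x : Balaban1983to89.Site P j) (μ : Fin P.d) :
    (holCK (bg454 k v θ) k x)⁻¹ * toC (v ⟨blkIter k x, μ⟩) * holCK (bg454 k v θ) k (runSite x μ (P.L ^ k))
        * (toC (runProd (bg454 k v θ) x μ (P.L ^ k)))⁻¹
      = (holCK (phase θ) k x)⁻¹ * holCK (phase θ) k (runSite x μ (P.L ^ k)) * (toC (runProd (phase θ) x μ (P.L ^ k)))⁻¹ := by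
  rw [holCK_bg454 hk, holCK_bg454 hk, toC_runProd_bg454 hk, mul_inv]
  have hw : toC (v ⟨blkIter k x, μ⟩) ≠ 0 := toC_ne_zero _
  calc (holCK (phase θ) k x)⁻¹ * toC (v ⟨blkIter k x, μ⟩) * holCK (phase θ) k (runSite x μ (P.L ^ k))
          * ((toC (v ⟨blkIter k x, μ⟩))⁻¹ * (toC (runProd (phase θ) x μ (P.L ^ k)))⁻¹)
      = (toC (v ⟨blkIter k x, μ⟩) * (toC (v ⟨blkIter k x, μ⟩))⁻¹)
          * ((holCK (phase θ) k x)⁻¹ * holCK (phase θ) k (runSite x μ (P.L ^ k)) * (toC (runProd (phase θ) x μ (P.L ^ k)))⁻¹) := by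
        ring
    _ = _ := by rw [mul_inv_cancel₀ hw, one_mul]

/-- **THE HOLONOMY DEFECT OF THE BACKGROUND (4.5.4) IS SMALL WITH THE PHASE**: if `|θ_b| ≤ T` on every `η`-bond then for every `x`, `μ`
`|ρ_μ(x) − 1| ≤ (2d + 1)·L^k·T` — two composite tree transports (`≤ d(L^k − 1)T` each, file 2) and one straight run of `L^k` bonds (`≤ L^kT`).
[cite: BalabanImbrieJaffe1985, (7.3.1)–(7.3.2) p.326] -/
theorem norm_defect_bg454_sub_one_le {k : ℕ} (hk : j + k ≤ P.m + P.K) {θ : PBond P j → ℝ} {T : ℝ} (hT : 0 ≤ T)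
    (hθ : ∀ b, |θ b| ≤ T) (v : GaugeField P (j + k) U1) (x : Balaban1983to89.Site P j) (μ : Fin P.d) :
    ‖(holCK (bg454 k v θ) k x)⁻¹ * toC (v ⟨blkIter k x, μ⟩) * holCK (bg454 k v θ) k (runSite x μ (P.L ^ k))
        * (toC (runProd (bg454 k v θ) x μ (P.L ^ k)))⁻¹ - 1‖ ≤ (2 * P.d + 1) * ((P.L : ℝ) ^ k * T) := by
  rw [defect_bg454_eq hk]
  set A : ℂ := holCK (phase θ) k x with hA
  set B : ℂ := holCK (phase θ) k (runSite x μ (P.L ^ k)) with hB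
  set C : ℂ := toC (runProd (phase θ) x μ (P.L ^ k)) with hC
  have hph : ∀ b, ‖toC (phase θ b) - 1‖ ≤ T := norm_toC_phase_sub_one_le hθ
  have hAn : ‖A‖ = 1 := norm_holCK _ _ _
  have hBn : ‖B‖ = 1 := norm_holCK _ _ _
  have hCn : ‖C‖ = 1 := norm_toC _
  have h1 : ‖A⁻¹ - 1‖ ≤ P.d * ((P.L : ℝ) ^ k - 1) * T := by
    rw [norm_inv_sub_one hAn]; exact norm_holCK_sub_one_le hT hph k x
  have h2 : ‖B - 1‖ ≤ P.d * ((P.L : ℝ) ^ k - 1) * T := norm_holCK_sub_one_le hT hph k _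
  have h3 : ‖C⁻¹ - 1‖ ≤ (P.L ^ k : ℕ) * T := by
    rw [norm_inv_sub_one hCn]; exact norm_runProd_sub_one_le hph x μ (P.L ^ k)
  rw [Nat.cast_pow] at h3
  have h4 : ‖A⁻¹ * B * C⁻¹ - 1‖ ≤ ‖C⁻¹ - 1‖ + ‖B - 1‖ + ‖A⁻¹ - 1‖ := by
    calc ‖A⁻¹ * B * C⁻¹ - 1‖ = ‖A⁻¹ * (B * C⁻¹) - 1‖ := by rw [mul_assoc]
      _ ≤ ‖A⁻¹‖ * ‖B * C⁻¹ - 1‖ + ‖A⁻¹ - 1‖ := norm_mul_sub_one_le _ _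
      _ ≤ ‖A⁻¹‖ * (‖B‖ * ‖C⁻¹ - 1‖ + ‖B - 1‖) + ‖A⁻¹ - 1‖ :=
          add_le_add (mul_le_mul_of_nonneg_left (norm_mul_sub_one_le _ _) (norm_nonneg _)) le_rfl
      _ = ‖C⁻¹ - 1‖ + ‖B - 1‖ + ‖A⁻¹ - 1‖ := by rw [norm_inv, hAn, hBn, inv_one, one_mul, one_mul]
  have hd : (0 : ℝ) ≤ P.d := Nat.cast_nonneg _
  have e : (2 * P.d + 1) * ((P.L : ℝ) ^ k * T)
      - ((P.L : ℝ) ^ k * T + P.d * ((P.L : ℝ) ^ k - 1) * T + P.d * ((P.L : ℝ) ^ k - 1) * T) = 2 * P.d * T := by ring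
  nlinarith [h4, h1, h2, h3, mul_nonneg hd hT]

/-- **THE COVARIANT BLOCK-AVERAGING INEQUALITY AT THE BACKGROUND (4.5.4) WITH AN EXPLICIT `τ²`-DEFECT**: for every `v`, every phase with
`|θ_b| ≤ T`, every `φ : T_η → ℂ` (`j + k ≤ m + K`, `n = L^k`, `N = L^{kd}`, `τ = nT`):
`Σ_{y,μ} |v(⟨y,y+e_μ⟩)(Q_k(u)φ)(y+e_μ) − (Q_k(u)φ)(y)|² ≤ 2(n²/N)·Σ_b |u_bφ(b₊) − φ(b₋)|² + 2N^{−1}·((2d+1)τ)²·d·Σ_x |φ(x)|²`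
(p11's `sum_norm_qCovK_shift_sub_sq_le_cov` + `norm_defect_bg454_sub_one_le` + translation invariance of `Σ_x`). [cite: BalabanImbrieJaffe1985, (7.3.2) p.326] -/
theorem sum_norm_qCovK_bg454_shift_sub_sq_le {k : ℕ} (hk : j + k ≤ P.m + P.K) {θ : PBond P j → ℝ} {T : ℝ} (hT : 0 ≤ T)
    (hθ : ∀ b, |θ b| ≤ T) (v : GaugeField P (j + k) U1) (φ : HiggsField P j) :
    ∑ y : Balaban1983to89.Site P (j + k), ∑ μ : Fin P.d,
        ‖toC (v ⟨y, μ⟩) * qCovK (bg454 k v θ) k φ (y.shift μ) - qCovK (bg454 k v θ) k φ y‖ ^ 2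
      ≤ 2 * (((P.L : ℝ) ^ k) ^ 2 / (P.L : ℝ) ^ (k * P.d)) * ∑ b : PBond P j, ‖toC (bg454 k v θ b) * φ b.tgt - φ b.src‖ ^ 2
        + 2 * ((P.L : ℝ) ^ (k * P.d))⁻¹
          * (((2 * P.d + 1) * ((P.L : ℝ) ^ k * T)) ^ 2 * (P.d * ∑ x : Balaban1983to89.Site P j, ‖φ x‖ ^ 2)) := by
  have h := sum_norm_qCovK_shift_sub_sq_le_cov hk (bg454 k v θ) v φ
  refine h.trans (add_le_add le_rfl (mul_le_mul_of_nonneg_left ?_ (by positivity)))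
  calc ∑ x : Balaban1983to89.Site P j, ∑ μ : Fin P.d,
        ‖(holCK (bg454 k v θ) k x)⁻¹ * toC (v ⟨blkIter k x, μ⟩) * holCK (bg454 k v θ) k (runSite x μ (P.L ^ k))
            * (toC (runProd (bg454 k v θ) x μ (P.L ^ k)))⁻¹ - 1‖ ^ 2 * ‖φ (runSite x μ (P.L ^ k))‖ ^ 2
      ≤ ∑ x : Balaban1983to89.Site P j, ∑ μ : Fin P.d,
          ((2 * P.d + 1) * ((P.L : ℝ) ^ k * T)) ^ 2 * ‖φ (runSite x μ (P.L ^ k))‖ ^ 2 :=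
        sum_le_sum fun x _ => sum_le_sum fun μ _ => mul_le_mul_of_nonneg_right
          (pow_le_pow_left₀ (norm_nonneg _) (norm_defect_bg454_sub_one_le hk hT hθ v x μ) 2) (sq_nonneg _)
    _ = ((2 * P.d + 1) * ((P.L : ℝ) ^ k * T)) ^ 2
          * ∑ μ : Fin P.d, ∑ x : Balaban1983to89.Site P j, ‖φ (runSite x μ (P.L ^ k))‖ ^ 2 := by
        rw [sum_comm, mul_sum]
        exact sum_congr rfl fun μ _ => by rw [mul_sum]
    _ = ((2 * P.d + 1) * ((P.L : ℝ) ^ k * T)) ^ 2 * (P.d * ∑ x : Balaban1983to89.Site P j, ‖φ x‖ ^ 2) := by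
        rw [sum_congr rfl fun μ _ => sum_runSite_eq μ (P.L ^ k) (fun x => ‖φ x‖ ^ 2), sum_const, card_univ, Fintype.card_fin,
          nsmul_eq_mul]

/-! ## §3 Coercivity at the background (4.5.4) under `4d(d+1)τ² ≤ 1` -/

/-- **COERCIVITY AT THE BACKGROUND (4.5.4)**: if `|θ_b| ≤ T` on every `η`-bond and `4d(d+1)(L^kT)² ≤ 1` then for every `v` and every `φ`
`Σ_x |φ(x)|² ≤ 4n²·Σ_b |u_bφ(b₊) − φ(b₋)|² + 4N·Σ_y |(Q_k(u)φ)(y)|²` (`n = L^k`, `N = L^{kd}`; file 3's `sum_norm_sq_le_cov` with `|u_b − 1| ≤ T` inside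
the blocks — there `u_b = e^{iθ_b}` — and `|u(Γ^{(k)}_{x_k,x}) − 1| ≤ d(L^k − 1)T`). [cite: BalabanImbrieJaffe1985, (7.3.2) p.326] -/
theorem sum_norm_sq_le_bg454 {k : ℕ} (hk : j + k ≤ P.m + P.K) {θ : PBond P j → ℝ} {T : ℝ} (hT : 0 ≤ T) (hθ : ∀ b, |θ b| ≤ T)
    (hτ : 4 * P.d * (P.d + 1) * ((P.L : ℝ) ^ k * T) ^ 2 ≤ 1) (v : GaugeField P (j + k) U1) (φ : HiggsField P j) :
    ∑ x : Balaban1983to89.Site P j, ‖φ x‖ ^ 2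
      ≤ 4 * ((P.L : ℝ) ^ k) ^ 2 * ∑ b : PBond P j, ‖toC (bg454 k v θ b) * φ b.tgt - φ b.src‖ ^ 2
        + 4 * (P.L : ℝ) ^ (k * P.d) * ∑ y : Balaban1983to89.Site P (j + k), ‖qCovK (bg454 k v θ) k φ y‖ ^ 2 := by
  have hph : ∀ b, ‖toC (phase θ b) - 1‖ ≤ T := norm_toC_phase_sub_one_le hθ
  have hInt : ∀ b : PBond P j, blkIter k b.src = blkIter k b.tgt → ‖toC (bg454 k v θ b) - 1‖ ≤ T := fun b hb => by
    rw [bg454_of_interior hk v θ hb]; exact hph b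
  have hTree : ∀ x : Balaban1983to89.Site P j, ‖holCK (bg454 k v θ) k x - 1‖ ≤ P.d * ((P.L : ℝ) ^ k - 1) * T := fun x => by
    rw [holCK_bg454 hk]; exact norm_holCK_sub_one_le hT hph k x
  have h := sum_norm_sq_le_cov hk (bg454 k v θ) hInt hTree φ
  set n : ℝ := (P.L : ℝ) ^ k with hn
  set S : ℝ := ∑ b : PBond P j, ‖toC (bg454 k v θ b) * φ b.tgt - φ b.src‖ ^ 2 with hS
  set Q : ℝ := ∑ y : Balaban1983to89.Site P (j + k), ‖qCovK (bg454 k v θ) k φ y‖ ^ 2 with hQ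
  set F : ℝ := ∑ x : Balaban1983to89.Site P j, ‖φ x‖ ^ 2 with hF
  have hn1 : 1 ≤ n := one_le_pow₀ (by exact_mod_cast P.L_pos)
  have hd : (1 : ℝ) ≤ P.d := by exact_mod_cast P.hd
  have hS0 : 0 ≤ S := sum_nonneg fun _ _ => sq_nonneg _
  have hQ0 : 0 ≤ Q := sum_nonneg fun _ _ => sq_nonneg _
  have hF0 : 0 ≤ F := sum_nonneg fun _ _ => sq_nonneg _
  have hN0 : 0 ≤ (P.L : ℝ) ^ (k * P.d) := by positivity
  -- the two smallness terms are `≤ ½`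
  have hs1 : 2 * ((n - 1) * n) * P.d * T ^ 2 ≤ 2 * P.d * (n * T) ^ 2 := by
    have : (n - 1) * n ≤ n * n := by nlinarith
    have hT2 : 0 ≤ T ^ 2 := sq_nonneg _
    nlinarith [mul_nonneg (mul_nonneg (by linarith : (0 : ℝ) ≤ P.d) hT2) (by linarith : 0 ≤ n * n - (n - 1) * n)]
  have hs2 : 2 * (P.d * (n - 1) * T) ^ 2 ≤ 2 * P.d ^ 2 * (n * T) ^ 2 := by
    have h' : (P.d * (n - 1) * T) ^ 2 = P.d ^ 2 * ((n - 1) * T) ^ 2 := by ring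
    rw [h']
    have h'' : ((n - 1) * T) ^ 2 ≤ (n * T) ^ 2 := by
      apply pow_le_pow_left₀ (by nlinarith) (by nlinarith)
    nlinarith [sq_nonneg (P.d : ℝ)]
  have hsmall : 2 * ((n - 1) * n) * P.d * T ^ 2 + 2 * (P.d * (n - 1) * T) ^ 2 ≤ 1 / 2 := by nlinarith
  -- absorb
  have hmain : (1 / 2 : ℝ) * F ≤ 2 * ((n - 1) * n) * S + 2 * (P.L : ℝ) ^ (k * P.d) * Q := by
    have h1 : (1 / 2 : ℝ) * F ≤ (1 - (2 * ((n - 1) * n) * P.d * T ^ 2 + 2 * (P.d * (n - 1) * T) ^ 2)) * F :=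
      mul_le_mul_of_nonneg_right (by linarith) hF0
    exact h1.trans h
  have h2 : 2 * ((n - 1) * n) * S ≤ 2 * n ^ 2 * S := by nlinarith
  nlinarith

/-! ## §4 The block-averaging bound at the background (4.5.4) in the `ℓ²` bookkeeping -/

/-- **THE BLOCK-AVERAGING BOUND AT THE BACKGROUND (4.5.4) in the `ℓ²` bookkeeping**: for every `v`, `|θ_b| ≤ T`, `4d(d+1)τ² ≤ 1` (`τ = L^kT`)
and every `φ`, `E_v(Q_k(u)φ) ≤ (n²/N)(2 + 8d(2d+1)²τ²)·Σ_b|u_bφ(b₊) − φ(b₋)|² + 8d(2d+1)²τ²·‖Q_k(u)φ‖²` (§2 + §3).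
[cite: BalabanImbrieJaffe1985, (7.3.2) p.326] -/
theorem bondForm_qlinK_bg454_le {k : ℕ} (hk : j + k ≤ P.m + P.K) {θ : PBond P j → ℝ} {T : ℝ} (hT : 0 ≤ T) (hθ : ∀ b, |θ b| ≤ T)
    (hτ : 4 * P.d * (P.d + 1) * ((P.L : ℝ) ^ k * T) ^ 2 ≤ 1) (v : GaugeField P (j + k) U1) (φ : FineSp P j) :
    bondForm v (QlinK (bg454 k v θ) k φ)
      ≤ (((P.L : ℝ) ^ k) ^ 2 / (P.L : ℝ) ^ (k * P.d) * (2 + 8 * P.d * (2 * P.d + 1) ^ 2 * ((P.L : ℝ) ^ k * T) ^ 2))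
          * ∑ b : PBond P j, ‖toC (bg454 k v θ b) * φ b.tgt - φ b.src‖ ^ 2
        + (8 * P.d * (2 * P.d + 1) ^ 2 * ((P.L : ℝ) ^ k * T) ^ 2) * ‖QlinK (bg454 k v θ) k φ‖ ^ 2 := by
  have hL : bondForm v (QlinK (bg454 k v θ) k φ) = ∑ y : Balaban1983to89.Site P (j + k), ∑ μ : Fin P.d,
      ‖toC (v ⟨y, μ⟩) * qCovK (bg454 k v θ) k (WithLp.ofLp φ) (y.shift μ) - qCovK (bg454 k v θ) k (WithLp.ofLp φ) y‖ ^ 2 := by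
    unfold bondForm; rw [sum_bond_eq]; rfl
  have hQ : ‖QlinK (bg454 k v θ) k φ‖ ^ 2
      = ∑ y : Balaban1983to89.Site P (j + k), ‖qCovK (bg454 k v θ) k (WithLp.ofLp φ) y‖ ^ 2 := by
    rw [← sum_norm_sq_eq]; rfl
  have h1 := sum_norm_qCovK_bg454_shift_sub_sq_le hk hT hθ v (WithLp.ofLp φ)
  have h2 := sum_norm_sq_le_bg454 hk hT hθ hτ v (WithLp.ofLp φ)
  set n : ℝ := (P.L : ℝ) ^ k with hn
  set N : ℝ := (P.L : ℝ) ^ (k * P.d) with hN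
  set τ : ℝ := n * T with hτdef
  set S : ℝ := ∑ b : PBond P j, ‖toC (bg454 k v θ b) * (WithLp.ofLp φ) b.tgt - (WithLp.ofLp φ) b.src‖ ^ 2 with hS
  set Qs : ℝ := ∑ y : Balaban1983to89.Site P (j + k), ‖qCovK (bg454 k v θ) k (WithLp.ofLp φ) y‖ ^ 2 with hQs
  set F : ℝ := ∑ x : Balaban1983to89.Site P j, ‖(WithLp.ofLp φ) x‖ ^ 2 with hF
  have hNpos : 0 < N := pow_pos (Nat.cast_pos.2 P.L_pos) _
  rw [hL, hQ]
  have hdef : 2 * N⁻¹ * (((2 * P.d + 1) * τ) ^ 2 * (P.d * F))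
      ≤ 2 * N⁻¹ * (((2 * P.d + 1) * τ) ^ 2 * (P.d * (4 * n ^ 2 * S + 4 * N * Qs))) := by
    have hd : (0 : ℝ) ≤ P.d := Nat.cast_nonneg _
    have := mul_le_mul_of_nonneg_left h2 hd
    exact mul_le_mul_of_nonneg_left (mul_le_mul_of_nonneg_left this (sq_nonneg _)) (by positivity)
  refine (h1.trans (add_le_add le_rfl hdef)).trans (le_of_eq ?_)
  field_simp
  ring


end

end Literature.MathematicalPhysics.QuantumFieldTheory.BalabanImbrieJaffe1984to88.BIJ85Ineq732Background
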